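import Summits.KontsevichZagierPeriods.KontsevichZagierPeriods.Theorems.LinRedNormalFormArrangementNormalFormSeparateThreeInduction
import Summits.KontsevichZagierPeriods.KontsevichZagierPeriods.Theorems.LinRedNormalFormArrangementNormalFormSeparateThreeTerminal
import Summits.KontsevichZagierPeriods.KontsevichZagierPeriods.Theorems.LinRedNormalFormArrangementNormalFormSeparateThreeUnblocked
import Summits.KontsevichZagierPeriods.KontsevichZagierPeriods.Theorems.LinRedNormalFormArrangementNormalFormSeparateDominated
import Summits.KontsevichZagierPeriods.KontsevichZagierPeriods.Theorems.LinRedNormalFormArrangementNormalFormSeparateTwoZeroCandidates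

/-!
# The piece theorem of the 3-d engine (stub `stub_separateThreeZero`, part `Piece`)

(Line `janus-bands`, crux `ArrangementNormalForm`, stub `stub_separateThreeZero` — fibre-free
separation over a bounded rational polytope in `ℝ³`, `JJ 3 0 → closure (GG 2 1 0)`; part `Piece`.)

`SepThree.piece` (registered as `separateThree_piece`): a literal arrangement representation
over a bounded polyhedral cell in `ℝ³` in ENGINE COORDINATES — distinguished coordinate
`y = z (Fin.last 2)`, every active non-constant letter is a `y`-letter (`hact`), active
`y`-letters do not vanish on the open cell (`hpole`), the RATIO condition holds for every ordered
pair of non-proportional active `y`-letters (`hrat`), every active `y`-letter has THIN contact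
with a set `K₀ ⊇` the closed cell (`hthin`), and the closed cell contains at most one SPECIAL
POINT of `K₀` (`hsep`) — is congruent modulo `KZ.relations` to a `ℤ`-combination of elements of
`GG 2 1 0`, GIVEN the dimension-3 termwise-convergence lemma `hHI₃` (`separateThree_hI`):
the contact-aware engine `SepThree.sepC_induction` (order of the splittings by the splitting
rule, `SepThree.hunb_of_thin`) with the terminal theorem `SepThree.terminal`.
-/

noncomputable section

open Set MeasureTheory Filter Topology

namespace Summit.KontsevichZagierPeriods.ArrangementNormalForm.JanusBands

open Literature.NumberTheory.Transcendental

namespace SepThree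

open SeparatePos MvPolynomial

/-- The zero set of a `y`-letter is its pole plane. -/
theorem letter_zero_iff {b k : ℕ} (c : (Fin (b + 1) → ℚ) × ℚ) (hc : c.1 (Fin.last b) ≠ 0)
    (z : Fin (b + 1 + k) → ℝ) :
    affF b k c z = 0 ↔ z (Fin.castAdd k (Fin.last b)) = affB b k (root b c) z := by
  rw [affF_of_ne_zero c z hc, mul_eq_zero, sub_eq_zero]
  have hα : (c.1 (Fin.last b) : ℝ) ≠ 0 := by exact_mod_cast hc
  exact ⟨fun h => h.resolve_left hα, fun h => Or.inr h⟩

/-- **Piece theorem of the 3-d engine**: see the module docstring. -/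
theorem piece
    (hHI₃ : ∀ (b k m m' n : ℕ) (s : KZ.IntegralRep (b + 1 + k)) (M : Fin m' → (Fin (b + 1) → ℚ) × ℚ) (L : Fin m → (Fin b → ℚ) × ℚ) (e : Fin m → ℕ) (p : MvPolynomial (Fin (b + 1)) ℚ) (ℓ : (Fin b → ℚ) × ℚ) (a : Fin k → Option ((Fin (b + 1) → ℚ) × ℚ)) (lo hi : Fin k → Fin k ⊕ ((Fin (b + 1) → ℚ) × ℚ)) (hpole : n ≠ 0 → ∀ z ∈ s.domain, (z (Fin.castAdd k (Fin.last b)) - (∑ i, (ℓ.1 i : ℝ) * z (Fin.castAdd k (Fin.castSucc i)) + (ℓ.2 : ℝ))) ≠ 0) (hbd : Bornology.IsBounded s.domain) (hdom : s.domain = {z | (∀ j, 0 < ∑ i, ((M j).1 i : ℝ) * z (Fin.castAdd k i) + ((M j).2 : ℝ)) ∧ ∀ i, Sum.elim (fun j => z (Fin.natAdd (b + 1) j)) (fun c => ∑ i', (c.1 i' : ℝ) * z (Fin.castAdd k i') + (c.2 : ℝ)) (lo i) < z (Fin.natAdd (b + 1) i) ∧ z (Fin.natAdd (b + 1) i) <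 Sum.elim (fun j => z (Fin.natAdd (b + 1) j)) (fun c => ∑ i', (c.1 i' : ℝ) * z (Fin.castAdd k i') + (c.2 : ℝ)) (hi i)}) (hint : EqOn s.integrand (fun z => MvPolynomial.aeval (fun i => z (Fin.castAdd k i)) p / (∏ j, (∑ i, ((L j).1 i : ℝ) * z (Fin.castAdd k (Fin.castSucc i)) + ((L j).2 : ℝ)) ^ e j) * (1 / (z (Fin.castAdd k (Fin.last b)) - (∑ i, (ℓ.1 i : ℝ) * z (Fin.castAdd k (Fin.castSucc i)) + (ℓ.2 : ℝ))) ^ n) * ∏ i, (a i).elim 1 (fun c => 1 / (z (Fin.natAdd (b + 1) i) - (∑ i', (c.1 i' : ℝ) * z (Fin.castAdd k i') + (c.2 : ℝ))))) s.domain) (N : ℕ) (q : ℕ → MvPolynomial (Fin b) ℚ) (hq : ∀ z : Fin (b + 1 + k) → ℝ, MvPolynomial.aeval (fun i => z (Fin.castAdd k i)) p = ∑ i ∈ Finset.range N, MvPolynomial.aeval (fun i => z (Fin.castAdd k (Fin.castSucc i))) (q i) * (z (Fin.castAdd k (Fin.last b)) - (∑ i, (ℓ.1 i : ℝ) * z (Fin.castAdd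 k (Fin.castSucc i)) + (ℓ.2 : ℝ))) ^ i) (hb : b = 2) (hk : k = 0) (hR : ∀ z ∈ closure s.domain, (∃ j, e j ≠ 0 ∧ (∑ i, ((L j).1 i : ℝ) * z (Fin.castAdd k (Fin.castSucc i)) + ((L j).2 : ℝ)) = 0) → (n ≠ 0 ∧ z (Fin.castAdd k (Fin.last b)) = ∑ i, (ℓ.1 i : ℝ) * z (Fin.castAdd k (Fin.castSucc i)) + (ℓ.2 : ℝ)) ∨ (∃ z' ∈ closure s.domain, z' ≠ z ∧ ∀ i : Fin b, z' (Fin.castAdd k (Fin.castSucc i)) = z (Fin.castAdd k (Fin.castSucc i)))), ∀ i ∈ Finset.range N, IntegrableOn (fun z => MvPolynomial.aeval (fun i => z (Fin.castAdd k (Fin.castSucc i))) (q i) / (∏ j, (∑ i, ((L j).1 i : ℝ) * z (Fin.castAdd k (Fin.castSucc i)) + ((L j).2 : ℝ)) ^ e j) * ((z (Fin.castAdd k (Fin.last b)) - (∑ i, (ℓ.1 i : ℝ) * z (Fin.castAdd k (Fin.castSucc i)) + (ℓ.2 : ℝ))) ^ i / (z (Fin.castAdd k (Fin.last b)) - (∑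 i, (ℓ.1 i : ℝ) * z (Fin.castAdd k (Fin.castSucc i)) + (ℓ.2 : ℝ))) ^ n) * ∏ i, (a i).elim 1 (fun c => 1 / (z (Fin.natAdd (b + 1) i) - (∑ i', (c.1 i' : ℝ) * z (Fin.castAdd k i') + (c.2 : ℝ))))) s.domain)
    {m m' : ℕ} (s : KZ.IntegralRep (2 + 1 + 0))
    (M : Fin m' → (Fin (2 + 1) → ℚ) × ℚ) (L : Fin m → (Fin (2 + 1) → ℚ) × ℚ) (e : Fin m → ℕ)
    (p : MvPolynomial (Fin (2 + 1)) ℚ) (a : Fin 0 → Option ((Fin (2 + 1) → ℚ) × ℚ))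
    (lo hi : Fin 0 → Fin 0 ⊕ ((Fin (2 + 1) → ℚ) × ℚ))
    (hbd : Bornology.IsBounded s.domain) (hdom : s.domain = gDom 2 0 m' M lo hi)
    (hint : EqOn s.integrand (fun z => MvPolynomial.aeval (fun i => z (Fin.castAdd 0 i)) p /
      (∏ j, affF 2 0 (L j) z ^ e j) * fib 2 0 a z) s.domain)
    (hact : ∀ j, e j ≠ 0 → (L j).1 ≠ 0 → (L j).1 (Fin.last 2) ≠ 0)
    (hpole : ∀ j, (L j).1 (Fin.last 2) ≠ 0 → e j ≠ 0 → ∀ z ∈ s.domain, affF 2 0 (L j) z ≠ 0)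
    (hrat : ∀ j j', (L j).1 (Fin.last 2) ≠ 0 → (L j').1 (Fin.last 2) ≠ 0 → e j ≠ 0 → e j' ≠ 0 →
      (L j').1 (Fin.last 2) • L j ≠ (L j).1 (Fin.last 2) • L j' → ∃ C : ℝ, ∀ z ∈ s.domain,
      |affF 2 0 (L j') z| ≤ C * |((L j).1 (Fin.last 2) : ℝ) * affF 2 0 (L j') z -
        ((L j').1 (Fin.last 2) : ℝ) * affF 2 0 (L j) z|)
    (K₀ : Set (Fin (2 + 1 + 0) → ℝ)) (hK₀ : closure s.domain ⊆ K₀)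
    (hthin : ∀ j, (L j).1 (Fin.last 2) ≠ 0 → e j ≠ 0 → ∃ P u : Fin (2 + 1 + 0) → ℝ, ∀ z ∈ K₀,
      affF 2 0 (L j) z = 0 → ∃ t : ℝ, z = P + t • u)
    (hsep : ∀ X X' : Fin (2 + 1 + 0) → ℝ, X ∈ closure s.domain → X' ∈ closure s.domain →
      (∃ j j', ((L j).1 (Fin.last 2) ≠ 0 ∧ e j ≠ 0) ∧ ((L j').1 (Fin.last 2) ≠ 0 ∧ e j' ≠ 0) ∧
        root 2 (L j) ≠ root 2 (L j') ∧
        {z | affF 2 0 (L j) z = 0} ∩ {z | affF 2 0 (L j') z = 0} ∩ K₀ = {X}) →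
      (∃ j j', ((L j).1 (Fin.last 2) ≠ 0 ∧ e j ≠ 0) ∧ ((L j').1 (Fin.last 2) ≠ 0 ∧ e j' ≠ 0) ∧
        root 2 (L j) ≠ root 2 (L j') ∧
        {z | affF 2 0 (L j) z = 0} ∩ {z | affF 2 0 (L j') z = 0} ∩ K₀ = {X'}) → X = X') :
    ∃ c ∈ AddSubgroup.closure (GGset 2 1 0), KZ.of s - c ∈ KZ.relations := by
  classical
  -- a vanishing active letter makes the integrand zero
  by_cases hL : ∃ j, e j ≠ 0 ∧ L j = 0
  · obtain ⟨j, hej, hLj⟩ := hL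
    refine ⟨0, zero_mem _, ?_⟩
    rw [sub_zero]
    refine KZ.of_mem_relations_of_eqOn_zero s fun z hz => ?_
    rw [hint hz]
    have h0 : affF 2 0 (L j) z ^ e j = 0 := by
      rw [hLj]; simp [affF, zero_pow hej]
    simp only [Pi.zero_apply]
    rw [Finset.prod_eq_zero (Finset.mem_univ j) h0, div_zero, zero_mul]
  push Not at hL
  -- the separation shape of the input
  set lam : Fin m → (Fin 2 → ℚ) × ℚ := fun j => root 2 (L j) with hlam
  set d : Fin m → ℕ := fun j => if (L j).1 (Fin.last 2) = 0 then 0 else e j with hdd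
  set Lb : Fin m → (Fin 2 → ℚ) × ℚ := fun j => if (L j).1 (Fin.last 2) = 0 then restr 2 (L j)
    else (0, 1) with hLb
  set eb : Fin m → ℕ := fun j => if (L j).1 (Fin.last 2) = 0 then e j else 0 with heb
  set p' : MvPolynomial (Fin (2 + 1)) ℚ := MvPolynomial.C (∏ j, lead 2 (L j) (e j))⁻¹ * p with hp'
  have hd : ∀ j, d j ≠ 0 → (L j).1 (Fin.last 2) ≠ 0 ∧ e j ≠ 0 := fun j hj => by
    have hdj : d j = if (L j).1 (Fin.last 2) = 0 then 0 else e j := rfl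
    by_cases h : (L j).1 (Fin.last 2) = 0
    · rw [hdj, if_pos h] at hj; exact absurd rfl hj
    · rw [hdj, if_neg h] at hj; exact ⟨h, hj⟩
  have hshape : EqOn s.integrand (shape 2 0 p' Lb eb lam d a) s.domain := fun z hz => by
    rw [hint hz]; exact jshape_eq L e _ a z
  set act : Fin m → Prop := fun j => (L j).1 (Fin.last 2) ≠ 0 ∧ e j ≠ 0 with hactdef
  -- the hypotheses of the engine
  have hpole' : ∀ j, d j ≠ 0 → ∀ z ∈ s.domain,
      z (Fin.castAdd 0 (Fin.last 2)) - affB 2 0 (lam j) z ≠ 0 := fun j hj z hz => by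
    obtain ⟨hα, he⟩ := hd j hj
    have h := hpole j hα he z hz
    rw [affF_of_ne_zero (L j) z hα] at h
    exact right_ne_zero_of_mul h
  have hrat' : ∀ j j', act j → act j' → lam j ≠ lam j' →
      ∃ C, ∀ z ∈ gDom 2 0 m' M lo hi, |z (Fin.castAdd 0 (Fin.last 2)) - affB 2 0 (lam j') z| ≤
        C * |affB 2 0 (lam j) z - affB 2 0 (lam j') z| := by
    rintro j j' ⟨hα, he⟩ ⟨hα', he'⟩ hne
    obtain ⟨C, hC⟩ := hrat j j' hα hα' he he' fun h => hne (root_eq_of_smul_eq hα hα' h)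
    rw [← hdom]
    exact ⟨C * |((L j).1 (Fin.last 2) : ℝ)|, fun z hz => ratio_of_literal (L j) (L j') hα hα' z
      (hC z hz)⟩
  have hplane : ∀ j, act j → {z : Fin (2 + 1 + 0) → ℝ | z (Fin.castAdd 0 (Fin.last 2)) =
      affB 2 0 (lam j) z} = {z | affF 2 0 (L j) z = 0} := fun j hj => by
    ext z; exact (letter_zero_iff (L j) hj.1 z).symm
  have hunb := hunb_of_thin M lo hi lam act K₀ (hdom ▸ hK₀)
    (fun j hj => by
      obtain ⟨P, u, h⟩ := hthin j hj.1 hj.2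
      exact ⟨P, u, fun z hz h0 => h z hz ((letter_zero_iff (L j) hj.1 z).2 h0)⟩)
    (fun X X' hX hX' h1 h2 => by
      rw [← hdom] at hX hX'
      refine hsep X X' hX hX' ?_ ?_
      · obtain ⟨j, j', hj, hj', hne, hX1⟩ := h1
        exact ⟨j, j', hj, hj', hne, by rw [← hplane j hj, ← hplane j' hj']; exact hX1⟩
      · obtain ⟨j, j', hj, hj', hne, hX1⟩ := h2
        exact ⟨j, j', hj, hj', hne, by rw [← hplane j hj, ← hplane j' hj']; exact hX1⟩)
  have hinv0 : ∀ l, eb l ≠ 0 → ∀ z ∈ closure s.domain, affB 2 0 (Lb l) z = 0 →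
      (∃ i, d i ≠ 0) ∧ ∀ i, d i ≠ 0 → z (Fin.castAdd 0 (Fin.last 2)) = affB 2 0 (lam i) z := by
    intro l hl z _ h0
    exfalso
    have hel : eb l = if (L l).1 (Fin.last 2) = 0 then e l else 0 := rfl
    by_cases hy : (L l).1 (Fin.last 2) = 0
    · rw [hel, if_pos hy] at hl
      have hlin : (L l).1 = 0 := by
        by_contra h; exact hact l hl h hy
      have hc2 : (L l).2 ≠ 0 := fun h => hL l hl (Prod.ext hlin h)
      have hL' : Lb l = restr 2 (L l) := by
        show (if (L l).1 (Fin.last 2) = 0 then restr 2 (L l) else (0, 1)) = _; rw [if_pos hy]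
      rw [hL'] at h0
      simp only [affB, restr, hlin, Pi.zero_apply, Rat.cast_zero, zero_mul,
        Finset.sum_const_zero, zero_add, Rat.cast_eq_zero] at h0
      exact hc2 h0
    · rw [hel, if_neg hy] at hl; exact hl rfl
  -- separation + terminal theorem
  set T : Set KZ.FormalRep := {w | ∃ c ∈ AddSubgroup.closure (GGset 2 1 0),
    w - c ∈ KZ.relations} with hTdef
  have hT := fun (n : ℕ) (L' : Fin n → (Fin 2 → ℚ) × ℚ) (e' : Fin n → ℕ) (d' : Fin m → ℕ)
    (s' : KZ.IntegralRep (2 + 1 + 0)) (ℓ : (Fin 2 → ℚ) × ℚ) hbd'' hdom' hint' hpole'' hℓ hinv =>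
    show KZ.of s' ∈ T from
      terminal hHI₃ M p' lam a lo hi L' e' d' s' ℓ hbd'' hdom' hint' hpole'' hℓ hinv
  obtain ⟨c, hc, hsc⟩ := sepC_induction 2 0 m' m M p' lam a lo hi act T hT hrat' hunb (∑ j, d j)
    m Lb eb d s rfl hbd hdom hshape hpole' hd hinv0
  obtain ⟨c', hc', hcc⟩ := SepTwoZero.closure_transfer' (S := T) (T := GGset 2 1 0)
    (fun x hx => hx) c hc
  refine ⟨c', hc', ?_⟩
  have := add_mem hsc hcc
  rwa [sub_add_sub_cancel] at this

end SepThree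

open SepThree SeparatePos in
/-- **Piece theorem of the 3-d engine** (registered sub-goal of `stub_separateThreeZero`; see
`SepThree.piece` and the module docstring). -/
theorem separateThree_piece (hHI₃ : ∀ (b k m m' n : ℕ) (s : KZ.IntegralRep (b + 1 + k)) (M : Fin m' → (Fin (b + 1) → ℚ) × ℚ) (L : Fin m → (Fin b → ℚ) × ℚ) (e : Fin m → ℕ) (p : MvPolynomial (Fin (b + 1)) ℚ) (ℓ : (Fin b → ℚ) × ℚ) (a : Fin k → Option ((Fin (b + 1) → ℚ) × ℚ)) (lo hi : Fin k → Fin k ⊕ ((Fin (b + 1) → ℚ) × ℚ)) (hpole : n ≠ 0 → ∀ z ∈ s.domain, (z (Fin.castAdd k (Fin.last b)) - (∑ i, (ℓ.1 i : ℝ) * z (Fin.castAdd k (Fin.castSucc i)) + (ℓ.2 : ℝ))) ≠ 0) (hbd : Bornology.IsBounded s.domain) (hdom : s.domain = {z | (∀ j, 0 < ∑ i, ((M j).1 i : ℝ) * z (Fin.castAdd k i) + ((M j).2 : ℝ)) ∧ ∀ i, Sum.elim (fun j => z (Fin.natAdd (b + 1) j)) (fun c => ∑ i', (c.1 i' : ℝ)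 * z (Fin.castAdd k i') + (c.2 : ℝ)) (lo i) < z (Fin.natAdd (b + 1) i) ∧ z (Fin.natAdd (b + 1) i) < Sum.elim (fun j => z (Fin.natAdd (b + 1) j)) (fun c => ∑ i', (c.1 i' : ℝ) * z (Fin.castAdd k i') + (c.2 : ℝ)) (hi i)}) (hint : EqOn s.integrand (fun z => MvPolynomial.aeval (fun i => z (Fin.castAdd k i)) p / (∏ j, (∑ i, ((L j).1 i : ℝ) * z (Fin.castAdd k (Fin.castSucc i)) + ((L j).2 : ℝ)) ^ e j) * (1 / (z (Fin.castAdd k (Fin.last b)) - (∑ i, (ℓ.1 i : ℝ) * z (Fin.castAdd k (Fin.castSucc i)) + (ℓ.2 : ℝ))) ^ n) * ∏ i, (a i).elim 1 (fun c => 1 / (z (Fin.natAdd (b + 1) i) - (∑ i', (c.1 i' : ℝ) * z (Fin.castAdd k i') + (c.2 : ℝ))))) s.domain) (N : ℕ) (q : ℕ → MvPolynomial (Fin b) ℚ) (hq : ∀ z : Fin (b + 1 + k) → ℝ, MvPolynomial.aeval (fun i => z (Fin.castAdd k i)) p = ∑ i ∈ Finset.range N, MvPolynomial.aeval (fun i =>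 z (Fin.castAdd k (Fin.castSucc i))) (q i) * (z (Fin.castAdd k (Fin.last b)) - (∑ i, (ℓ.1 i : ℝ) * z (Fin.castAdd k (Fin.castSucc i)) + (ℓ.2 : ℝ))) ^ i) (hb : b = 2) (hk : k = 0) (hR : ∀ z ∈ closure s.domain, (∃ j, e j ≠ 0 ∧ (∑ i, ((L j).1 i : ℝ) * z (Fin.castAdd k (Fin.castSucc i)) + ((L j).2 : ℝ)) = 0) → (n ≠ 0 ∧ z (Fin.castAdd k (Fin.last b)) = ∑ i, (ℓ.1 i : ℝ) * z (Fin.castAdd k (Fin.castSucc i)) + (ℓ.2 : ℝ)) ∨ (∃ z' ∈ closure s.domain, z' ≠ z ∧ ∀ i : Fin b, z' (Fin.castAdd k (Fin.castSucc i)) = z (Fin.castAdd k (Fin.castSucc i)))), ∀ i ∈ Finset.range N, IntegrableOn (fun z => MvPolynomial.aeval (fun i => z (Fin.castAdd k (Fin.castSucc i))) (q i) / (∏ j, (∑ i, ((L j).1 i : ℝ) * z (Fin.castAdd k (Fin.castSucc i)) + ((L j).2 : ℝ)) ^ e j) * ((z (Fin.castAdd k (Fin.last b)) - (∑ i, (ℓ.1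 i : ℝ) * z (Fin.castAdd k (Fin.castSucc i)) + (ℓ.2 : ℝ))) ^ i / (z (Fin.castAdd k (Fin.last b)) - (∑ i, (ℓ.1 i : ℝ) * z (Fin.castAdd k (Fin.castSucc i)) + (ℓ.2 : ℝ))) ^ n) * ∏ i, (a i).elim 1 (fun c => 1 / (z (Fin.natAdd (b + 1) i) - (∑ i', (c.1 i' : ℝ) * z (Fin.castAdd k i') + (c.2 : ℝ))))) s.domain) (m m' : ℕ) (s : KZ.IntegralRep (2 + 1 + 0)) (M : Fin m' → (Fin (2 + 1) → ℚ) × ℚ) (L : Fin m → (Fin (2 + 1) → ℚ) × ℚ) (e : Fin m → ℕ) (p : MvPolynomial (Fin (2 + 1)) ℚ) (a : Fin 0 → Option ((Fin (2 + 1) → ℚ) × ℚ)) (lo hi : Fin 0 → Fin 0 ⊕ ((Fin (2 + 1) → ℚ) × ℚ)) (hbd : Bornology.IsBounded s.domain) (hdom : s.domain = SeparatePos.gDom 2 0 m' M lo hi) (hint : EqOn s.integrand (fun z => MvPolynomial.aeval (fun i => z (Fin.castAdd 0 i)) p / (∏ j, SeparatePos.affF 2 0 (L j) z ^ e j) * SeparatePos.fib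 2 0 a z) s.domain) (hact : ∀ j, e j ≠ 0 → (L j).1 ≠ 0 → (L j).1 (Fin.last 2) ≠ 0) (hpole : ∀ j, (L j).1 (Fin.last 2) ≠ 0 → e j ≠ 0 → ∀ z ∈ s.domain, SeparatePos.affF 2 0 (L j) z ≠ 0) (hrat : ∀ j j', (L j).1 (Fin.last 2) ≠ 0 → (L j').1 (Fin.last 2) ≠ 0 → e j ≠ 0 → e j' ≠ 0 → (L j').1 (Fin.last 2) • L j ≠ (L j).1 (Fin.last 2) • L j' → ∃ C : ℝ, ∀ z ∈ s.domain, |SeparatePos.affF 2 0 (L j') z| ≤ C * |((L j).1 (Fin.last 2) : ℝ) * SeparatePos.affF 2 0 (L j') z - ((L j').1 (Fin.last 2) : ℝ) * SeparatePos.affF 2 0 (L j) z|) (K₀ : Set (Fin (2 + 1 + 0) → ℝ)) (hK₀ : closure s.domain ⊆ K₀) (hthin : ∀ j, (L j).1 (Fin.last 2) ≠ 0 → e j ≠ 0 → ∃ P u : Fin (2 + 1 + 0) → ℝ, ∀ z ∈ K₀, SeparatePos.affF 2 0 (L j) z = 0 → ∃ t : ℝ, z = P + t • u) (hsep : ∀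 X X' : Fin (2 + 1 + 0) → ℝ, X ∈ closure s.domain → X' ∈ closure s.domain → (∃ j j', ((L j).1 (Fin.last 2) ≠ 0 ∧ e j ≠ 0) ∧ ((L j').1 (Fin.last 2) ≠ 0 ∧ e j' ≠ 0) ∧ SeparatePos.root 2 (L j) ≠ SeparatePos.root 2 (L j') ∧ {z | SeparatePos.affF 2 0 (L j) z = 0} ∩ {z | SeparatePos.affF 2 0 (L j') z = 0} ∩ K₀ = {X}) → (∃ j j', ((L j).1 (Fin.last 2) ≠ 0 ∧ e j ≠ 0) ∧ ((L j').1 (Fin.last 2) ≠ 0 ∧ e j' ≠ 0) ∧ SeparatePos.root 2 (L j) ≠ SeparatePos.root 2 (L j') ∧ {z | SeparatePos.affF 2 0 (L j) z = 0} ∩ {z | SeparatePos.affF 2 0 (L j') z = 0} ∩ K₀ = {X'}) → X = X') : ∃ c ∈ AddSubgroup.closure (SeparatePos.GGset 2 1 0), KZ.of s - c ∈ KZ.relations :=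
  piece hHI₃ s M L e p a lo hi hbd hdom hint hact hpole hrat K₀ hK₀ hthin hsep

open SepThree SeparatePos in
/-- **The zero set of a `y`-letter is its pole plane** (registered sub-goal of
`stub_separateThreeZero`, part `Piece`; the dictionary between the literal hypotheses of
`separateThree_piece` and the pole planes of the engine). -/
theorem separateThree_letter_zero_iff (b k : ℕ) (c : (Fin (b + 1) → ℚ) × ℚ) (hc : c.1 (Fin.last b) ≠ 0) (z : Fin (b + 1 + k) → ℝ) : SeparatePos.affF b k c z = 0 ↔ z (Fin.castAdd k (Fin.last b)) = SeparatePos.affB b k (SeparatePos.root b c) z :=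
  letter_zero_iff c hc z

end Summit.KontsevichZagierPeriods.ArrangementNormalForm.JanusBands
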